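/-
Copyright (c) 2026. All rights reserved.
Released under Apache 2.0 license as described in the file LICENSE.
Authors: abc-iut cell, block C / W6 prover seat abc-iut-w6-d060 (gen 3).
-/
import Literature.IUT.LogVolume.UnitLogBoundaryRamificationRoots
import Literature.IUT.LogVolume.UnitLogValuationSpectrum
import HarnessLib

/-!
# `log_p(𝒪_K^×)` at the FIRST TIE LEVEL `s = e/(p−1)`, I: the key congruence modulo `𝔪^{s+1}`

Classical `p`-adic analysis (Serre, *Local Fields* IV §2; Washington, *Cyclotomic Fields* §5.1;
Koblitz Ch. IV §1–2; Neukirch ANT II (5.5)–(5.7)).  PROOF-ONLY file (no `def`, no named fact), first of four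
(`UnitLogFirstTieLevel`, `…Roots`, `…Gap`, `…InnerRadius`) generalising this seat's boundary trichotomy
`UnitLogBoundaryRamification*` (`e = p − 1`, i.e. `s = 1`) to EVERY index `e = s·(p − 1)`, `p` odd — the
indices EXCLUDED from abc-iut-c312-3's `LogEnvelope.innerRadius_closedForm` (`r_in = ⌊e/(p−1)⌋ + 1` for
`(p − 1) ∤ e`), because there the level `s` is a TIE level: the terms of index `1` and `p` of `log_p(1 + ϖˢa)`
have the same norm and the inner radius of `log_p(𝒪_K^×)` depends on `K` (on `ζ_p ∈ K`, see part IV).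

Setting: `K` a proper ultrametric normed `ℚ_p`-algebra field, `e = absRamificationIdx p K = s·(p−1)`, `ϖ` a
norm uniformizer, `π := ϖˢ` (`‖π‖^{p−1} = ‖p‖`: `π` sits EXACTLY at the convergence boundary `p^{−1/(p−1)}`).

* §1 (any `π ∈ K` with `‖π‖^{p−1} = p⁻¹`): `‖π‖ = p^{−1/(p−1)}`, `‖π‖·p^{1/(p−1)} = 1`, `c := π^{p−1}/p` is a UNIT;
* §2 KEY CONGRUENCE **`log_p(1 + πa) ≡ π·(a + c·a^p) (mod π²)`** for `a ∈ 𝒪` (`norm_logSeries_one_add_sub_le`):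
  every other term of the series is `O(π²)` by `(p−1)·v_p(N) + 2 ≤ N` (`N ∉ {1, p}`);
* §3 at the tie level: `𝔪^{s+1} ⊆ log_p(𝒪_K^×)` (abc-iut-c312-3's `closedBall_div_succ_subset_logUnits`,
  `⌊e/(p−1)⌋ = s`), `log_p : U^{(s+1)} → 𝔪^{s+1}` is an isometric bijection, `log_p` is `1`-Lipschitz on
  `U^{(s)}`, and the congruence in `𝔪^{s+1}`-form: for `a, b ∈ 𝒪`,
  **`log_p(1 + ϖˢa) ≡ ϖˢ·b (mod 𝔪^{s+1}) ⟺ a + c·a^p ≡ b (mod 𝔪)`** — modulo `𝔪^{s+1}`, `log_p` on `1 + 𝔪ˢ`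
  IS the additive polynomial `ā ↦ ā + c̄·ā^p` of the residue field.

Sequels: `UnitLogFirstTieLevelRoots` (`p`-th powers; `ζ_p ∈ K ⟺` the residue polynomial has a unit zero),
`UnitLogFirstTieLevelGap` (`ζ_p ∉ K ⇒ 𝔪ˢ ⊆ log_p(𝒪^×)`; `p ∤ s`: exact norms below the tie, the gap `(s − p, s)`),
`UnitLogFirstTieLevelInnerRadius` (`r_in = s + [ζ_p ∈ K]`, the sphere at the tie level, abc-iut-c312-5's
binders).  Consumers (record only; D-0079 R-W lane U): the inner-radius column at places with `(p−1) ∣ e_w`,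
`p ∤ e_w` (e.g. `p = 7`, `e_w ∈ {30, 66, 78, 150, 330, 390}`).

References: [cite: NeukirchANT1999, Ch. II Prop. (5.5)–(5.7)] [cite: Koblitz1984, Ch. IV §1–2]
[cite: Washington1997, Lemma 1.4, §5.1].  Nothing here is disputed
mathematics; no IUT statement is asserted; the name `logUnits` is the cell's typing of [IUTchIV] Prop. 1.2's
`log_p(R^×)` ([claim: Mochizuki2012, status: disputed] for that locution only).  No side is taken on
[IUTchIII] Cor. 3.12 or on any author.
-/

noncomputable section

open Metric Set IsUltrametricDist IsLocalRing
open scoped Pointwise NormedField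

namespace Literature.IUT.LogVolume

open Literature.NumberTheory.GaloisRepresentations.Ultrametric Literature.NumberTheory.Transcendental
  BoundaryRamification

namespace FirstTieLevel

variable (p : ℕ) [hp : Fact p.Prime]
variable {K : Type*} [NontriviallyNormedField K] [instK : NormedAlgebra ℚ_[p] K] [IsUltrametricDist K]
  [ProperSpace K]

/-! ## 1. An element `π` at the convergence boundary: `‖π‖^{p−1} = p⁻¹` -/

section Boundary

variable {π : K} (hπ : ‖π‖ ^ (p - 1) = (p : ℝ)⁻¹)
include hπ

omit hp instK [IsUltrametricDist K] [ProperSpace K] in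
include hp in
/-- `‖π‖ > 0` when `‖π‖^{p−1} = p⁻¹`. [cite: Koblitz1984, Ch. IV §1] -/
theorem norm_pos_of_pow_eq : 0 < ‖π‖ := by
  have hp0 : (0 : ℝ) < (p : ℝ)⁻¹ := by
    have : (0 : ℝ) < p := by exact_mod_cast hp.out.pos
    positivity
  rcases (norm_nonneg π).eq_or_lt with h | h
  · exfalso
    rw [← h, zero_pow (by have := hp.out.two_le; omega)] at hπ
    exact hp0.ne hπ
  · exact h

omit instK [IsUltrametricDist K] [ProperSpace K] in
/-- `‖π‖ < 1` when `‖π‖^{p−1} = p⁻¹`. [cite: Koblitz1984, Ch. IV §1] -/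
theorem norm_lt_one_of_pow_eq : ‖π‖ < 1 := by
  have hp1 : (1 : ℝ) < p := by exact_mod_cast hp.out.one_lt
  have hlt : ‖π‖ ^ (p - 1) < 1 := by rw [hπ]; exact inv_lt_one_of_one_lt₀ hp1
  by_contra hge
  rw [not_lt] at hge
  exact absurd hlt (not_lt.mpr (one_le_pow₀ hge))

omit instK [IsUltrametricDist K] [ProperSpace K] in
/-- `‖π‖ = p^{−1/(p−1)}` when `‖π‖^{p−1} = p⁻¹`. [cite: Koblitz1984, Ch. IV §1] -/
theorem norm_eq_rpow_of_pow_eq : ‖π‖ = (p : ℝ) ^ (-(1 / ((p : ℝ) - 1))) := by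
  have hp1 : (1 : ℝ) < p := by exact_mod_cast hp.out.one_lt
  have hp0 : (0 : ℝ) < p := by linarith
  have hq0 : (p - 1 : ℕ) ≠ 0 := by have := hp.out.two_le; omega
  have hcast : ((p - 1 : ℕ) : ℝ) = (p : ℝ) - 1 := by
    rw [Nat.cast_sub hp.out.one_lt.le, Nat.cast_one]
  have h := Real.pow_rpow_inv_natCast (norm_nonneg π) hq0
  rw [hπ, hcast, Real.inv_rpow hp0.le, ← Real.rpow_neg hp0.le] at h
  rw [← h, one_div]

omit instK [IsUltrametricDist K] [ProperSpace K] in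
/-- `‖π‖ · p^{1/(p−1)} = 1`: at radius `‖π‖` the contraction modulus of the logarithmic series is exactly
`1`. [cite: Koblitz1984, Ch. IV §1] -/
theorem norm_mul_rpow_eq_one : ‖π‖ * (p : ℝ) ^ (1 / ((p : ℝ) - 1)) = 1 := by
  have hp1 : (1 : ℝ) < p := by exact_mod_cast hp.out.one_lt
  have hp0 : (0 : ℝ) < p := by linarith
  rw [norm_eq_rpow_of_pow_eq p hπ, ← Real.rpow_add hp0, neg_add_cancel, Real.rpow_zero]

omit instK [IsUltrametricDist K] [ProperSpace K] in
/-- `‖π‖² · p^{1/(p−1)} = ‖π‖ < 1`: at radius `‖π‖²` the logarithmic series contracts strictly.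
[cite: Koblitz1984, Ch. IV §2] -/
theorem sq_mul_rpow_lt_one : ‖π‖ ^ 2 * (p : ℝ) ^ (1 / ((p : ℝ) - 1)) < 1 := by
  rw [pow_two, mul_assoc, norm_mul_rpow_eq_one p hπ, mul_one]
  exact norm_lt_one_of_pow_eq p hπ

omit [IsUltrametricDist K] [ProperSpace K] in
/-- `‖p‖ = ‖π‖^{p−1}` in `K`. [cite: NeukirchANT1999, Ch. II Prop. (5.5)] -/
theorem norm_prime_eq_pow_of_pow_eq : ‖(p : K)‖ = ‖π‖ ^ (p - 1) := by
  rw [hπ, norm_prime p K]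

omit [IsUltrametricDist K] [ProperSpace K] in
/-- The coefficient `c := π^{p−1}/p` is a UNIT. [cite: Washington1997, §5.1] -/
theorem norm_coeff_eq_one : ‖π ^ (p - 1) / p‖ = 1 := by
  rw [norm_div, norm_pow, ← norm_prime_eq_pow_of_pow_eq p hπ]
  exact div_self (norm_pos_iff.mpr (prime_ne_zero p K)).ne'

end Boundary

/-! ## 2. The KEY CONGRUENCE `log_p(1 + πa) ≡ π·(a + c·a^p) (mod π²)` -/

section KeyCongruence

variable {π : K} (hπ : ‖π‖ ^ (p - 1) = (p : ℝ)⁻¹)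
include hπ

omit [IsUltrametricDist K] [ProperSpace K] in
/-- **Term estimate**: for `‖1 − y‖ ≤ ‖π‖` and `N = n + 1 ∉ {1, p}`, the `N`-th term of `L(y)` has norm
`≤ ‖π‖²` (`‖(1−y)^N/N‖ = ‖1−y‖^N·p^{v_p(N)} ≤ ‖π‖^{N − (p−1)v_p(N)} ≤ ‖π‖²`). [cite: Koblitz1984, Ch. IV §1] -/
theorem norm_logTerm_le_sq {y : K} (hy : ‖1 - y‖ ≤ ‖π‖) {n : ℕ} (hn0 : n ≠ 0)
    (hnp : n + 1 ≠ p) : ‖-((1 - y) ^ (n + 1)) / (n + 1 : K)‖ ≤ ‖π‖ ^ 2 := by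
  set r := ‖π‖ with hr
  have hr0 : 0 < r := norm_pos_of_pow_eq p hπ
  have hr1 : r < 1 := norm_lt_one_of_pow_eq p hπ
  have harith := sub_one_mul_padicValNat_add_two_le (p := p) (N := n + 1) (by omega) hnp
  set v := padicValNat p (n + 1) with hv
  rw [norm_logTerm_eq p K y n]
  have hpv : (p : ℝ) ^ v = (r ^ (p - 1))⁻¹ ^ v := by rw [hπ, inv_inv]
  calc ‖1 - y‖ ^ (n + 1) * (p : ℝ) ^ v ≤ r ^ (n + 1) * (p : ℝ) ^ v := by gcongr
    _ = r ^ ((n + 1 : ℕ) : ℤ) * (r ^ (((p - 1) * v : ℕ) : ℤ))⁻¹ := by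
        rw [hpv, zpow_natCast, zpow_natCast, inv_pow, pow_mul]
    _ = r ^ (((n + 1 : ℕ) : ℤ) - (((p - 1) * v : ℕ) : ℤ)) := by
        rw [zpow_sub₀ hr0.ne', div_eq_mul_inv]
    _ ≤ r ^ (2 : ℤ) := zpow_le_zpow_right_of_le_one₀ hr0 hr1.le (by omega)
    _ = r ^ 2 := zpow_ofNat r 2

omit [ProperSpace K] in
/-- **KEY CONGRUENCE** `log_p(1 + x) ≡ x + x^p/p (mod π²)` for `‖x‖ ≤ ‖π‖`, `p` odd:
`‖L(1 + x) − x − x^p/p‖ ≤ ‖π‖²` (all other terms of the series are `O(π²)`, `norm_logTerm_le_sq`).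
[cite: Koblitz1984, Ch. IV §1] [cite: Washington1997, §5.1] -/
theorem norm_logSeries_sub_sub_le [CompleteSpace K] (hp2 : p ≠ 2) {x : K} (hx : ‖x‖ ≤ ‖π‖) :
    ‖logSeries (1 + x) - x - x ^ p / p‖ ≤ ‖π‖ ^ 2 := by
  set r := ‖π‖ with hr
  have hr1 : r < 1 := norm_lt_one_of_pow_eq p hπ
  have hp3 : 3 ≤ p := by
    have := hp.out.two_le
    omega
  set y : K := 1 + x with hy
  have hxy : 1 - y = -x := by rw [hy]; ring
  have hy1 : ‖1 - y‖ < 1 := by rw [hxy, norm_neg]; exact hx.trans_lt hr1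
  set f : ℕ → K := fun n ↦ -((1 - y) ^ (n + 1)) / (n + 1 : K) with hf
  have hsum : HasSum f (logSeries y) := hasSum_logSeries p hy1
  -- the two distinguished terms
  have hf0 : f 0 = x := by
    simp only [hf, hxy, zero_add, pow_one, neg_neg, Nat.cast_zero, div_one]
  have hodd : Odd p := hp.out.odd_of_ne_two hp2
  have hfp : f (p - 1) = x ^ p / p := by
    simp only [hf, hxy]
    have h1 : p - 1 + 1 = p := by omega
    rw [h1, Odd.neg_pow hodd, neg_neg]
    congr 1
    have : ((p - 1 : ℕ) : K) + 1 = ((p - 1 + 1 : ℕ) : K) := by push_cast; ring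
    rw [this, h1]
  -- split the sum
  set S : Finset ℕ := {0, p - 1} with hS
  have h0p : (0 : ℕ) ≠ p - 1 := by omega
  have hsplit := hsum.summable.sum_add_tsum_compl (s := S)
  rw [hsum.tsum_eq] at hsplit
  have hssum : ∑ n ∈ S, f n = x + x ^ p / p := by
    rw [hS, Finset.sum_pair h0p, hf0, hfp]
  have hrest : logSeries y - x - x ^ p / p = ∑' n : ↥((S : Set ℕ)ᶜ), f n := by
    rw [← hsplit, hssum]; ring
  rw [hrest]
  refine IsUltrametricDist.norm_tsum_le_of_forall_le_of_nonneg (by positivity) fun n ↦ ?_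
  have hn : (n : ℕ) ∉ ({0, p - 1} : Finset ℕ) := by rw [← hS]; exact n.2
  rw [Finset.mem_insert, Finset.mem_singleton, not_or] at hn
  exact norm_logTerm_le_sq p hπ (by rw [hxy, norm_neg]; exact hx) hn.1 (by omega)

omit hp instK [IsUltrametricDist K] [ProperSpace K] hπ in
include hp instK in
/-- `x + x^p/p = π·(a + c·a^p)` for `x = πa`, `c = π^{p−1}/p`. [cite: Washington1997, §5.1] -/
theorem mul_add_pow_div_eq (a : K) :
    π * a + (π * a) ^ p / p = π * (a + π ^ (p - 1) / p * a ^ p) := by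
  have hp1 : p = (p - 1) + 1 := (Nat.sub_add_cancel hp.out.one_lt.le).symm
  have hp0 : (p : K) ≠ 0 := prime_ne_zero p K
  conv_lhs => rw [mul_pow, hp1, pow_succ]
  rw [← hp1]
  field_simp

omit [ProperSpace K] in
/-- **KEY CONGRUENCE, `Λ`-form**: for `‖a‖ ≤ 1`, `‖L(1 + πa) − π·(a + c·a^p)‖ ≤ ‖π‖²` with `c = π^{p−1}/p`:
modulo `π²`, `log_p` on `1 + π𝒪` is the additive polynomial `ā ↦ ā + c̄·ā^p` of the residue field.
[cite: Washington1997, §5.1] [cite: Koblitz1984, Ch. IV §1] -/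
theorem norm_logSeries_one_add_sub_le [CompleteSpace K] (hp2 : p ≠ 2) {a : K} (ha : ‖a‖ ≤ 1) :
    ‖logSeries (1 + π * a) - π * (a + π ^ (p - 1) / p * a ^ p)‖ ≤ ‖π‖ ^ 2 := by
  have hx : ‖π * a‖ ≤ ‖π‖ := by
    rw [norm_mul]; exact mul_le_of_le_one_right (norm_nonneg _) ha
  have h := norm_logSeries_sub_sub_le p hπ hp2 hx
  rwa [sub_sub, mul_add_pow_div_eq p a] at h

end KeyCongruence

/-! ## 3. The tie level `s = e/(p−1)`: bookkeeping, `𝔪^{s+1} ⊆ log_p(𝒪^×)`, the congruence modulo `𝔪^{s+1}` -/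

section Level

variable {ϖ : Kˣ} (hϖ : IsUniformizer ϖ) {s : ℕ} (he : absRamificationIdx p K = s * (p - 1))
include hϖ he

omit hϖ in
/-- `s ≥ 1` (as `e ≥ 1`). [cite: NeukirchANT1999, Ch. II Prop. (5.5)] -/
theorem one_le_level : 1 ≤ s := by
  have h := absRamificationIdx_pos p K
  rw [he] at h
  by_contra h0
  rw [not_le, Nat.lt_one_iff] at h0
  rw [h0, zero_mul] at h
  exact lt_irrefl 0 h

omit hϖ in
/-- `e/(p−1) = s`. [cite: NeukirchANT1999, Ch. II Prop. (5.5)] -/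
theorem div_pred_eq_level : absRamificationIdx p K / (p - 1) = s := by
  have hq0 : 0 < p - 1 := by have := hp.out.two_le; omega
  rw [he, Nat.mul_div_cancel _ hq0]

/-- **`π := ϖˢ` is at the convergence boundary: `‖ϖˢ‖^{p−1} = p⁻¹`.** [cite: NeukirchANT1999, Ch. II Prop. (5.5)] -/
theorem norm_pow_level_pow_eq : ‖(ϖ : K) ^ s‖ ^ (p - 1) = (p : ℝ)⁻¹ := by
  rw [norm_pow, ← pow_mul, ← he, norm_pow_absRamificationIdx p K hϖ]

/-- `‖p‖ = ‖ϖ‖^{s(p−1)} = ‖ϖˢ‖^{p−1}`. [cite: NeukirchANT1999, Ch. II Prop. (5.5)] -/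
theorem norm_prime_eq_norm_pow_level : ‖(p : K)‖ = ‖(ϖ : K)‖ ^ (s * (p - 1)) := by
  rw [norm_prime_eq_norm_pow p K hϖ, he]

/-- `‖ϖ‖^{s+1} · p^{1/(p−1)} = ‖ϖ‖ < 1`: strictly inside the tie level the logarithmic series contracts.
[cite: Koblitz1984, Ch. IV §2] -/
theorem pow_succ_mul_rpow_lt_one : ‖(ϖ : K)‖ ^ (s + 1) * (p : ℝ) ^ (1 / ((p : ℝ) - 1)) < 1 := by
  rw [pow_succ', mul_assoc, ← norm_pow, norm_mul_rpow_eq_one p (norm_pow_level_pow_eq p hϖ he), mul_one]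
  exact hϖ.norm_lt_one

/-- `‖ϖ‖^{2s} ≤ ‖ϖ‖^{s+1}` (`s ≥ 1`). [cite: NeukirchANT1999, Ch. II Prop. (5.5)] -/
theorem pow_two_mul_le_pow_succ : ‖(ϖ : K) ^ s‖ ^ 2 ≤ ‖(ϖ : K)‖ ^ (s + 1) := by
  rw [norm_pow, ← pow_mul]
  have h1 := one_le_level p he
  exact pow_le_pow_of_le_one (norm_nonneg _) hϖ.norm_lt_one.le (by omega)

/-- **`𝔪^{s+1} = {‖z‖ ≤ ‖ϖ‖^{s+1}} ⊆ log_p(𝒪_K^×)`** (abc-iut-c312-3's `closedBall_div_succ_subset_logUnits`,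
`⌊e/(p−1)⌋ = s`). [cite: NeukirchANT1999, Ch. II Prop. (5.5)] -/
theorem closedBall_pow_succ_subset_logUnits :
    closedBall (0 : K) (‖(ϖ : K)‖ ^ (s + 1)) ⊆ logUnits K := by
  have h := LogEnvelope.closedBall_div_succ_subset_logUnits p hϖ (K := K)
  rwa [div_pred_eq_level p he] at h

/-- `log_p` maps `U^{(s+1)}` ONTO `𝔪^{s+1}`: every `z` with `‖z‖ ≤ ‖ϖ‖^{s+1}` is `L(u)` with `‖1 − u‖ ≤ ‖ϖ‖^{s+1}`.
[cite: Koblitz1984, Ch. IV §2] -/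
theorem exists_logSeries_eq_of_norm_le_pow_succ {z : K} (hz : ‖z‖ ≤ ‖(ϖ : K)‖ ^ (s + 1)) :
    ∃ u : K, ‖1 - u‖ ≤ ‖(ϖ : K)‖ ^ (s + 1) ∧ logSeries u = z :=
  exists_logSeries_eq p K (pow_succ_mul_rpow_lt_one p hϖ he) hz

/-- `log_p` is INJECTIVE on `U^{(s+1)} = {‖1 − y‖ ≤ ‖ϖ‖^{s+1}}`. [cite: Koblitz1984, Ch. IV §2] -/
theorem logSeries_injOn_pow_succ :
    Set.InjOn (logSeries (K := K)) {y : K | ‖1 - y‖ ≤ ‖(ϖ : K)‖ ^ (s + 1)} :=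
  logSeries_injOn p K (pow_succ_mul_rpow_lt_one p hϖ he)

/-- `log_p` is an ISOMETRY on `U^{(s+1)}`: `‖L(y)‖ = ‖1 − y‖` for `‖1 − y‖ ≤ ‖ϖ‖^{s+1}`.
[cite: Koblitz1984, Ch. IV §1] -/
theorem norm_logSeries_eq_of_le_pow_succ {y : K} (hy : ‖1 - y‖ ≤ ‖(ϖ : K)‖ ^ (s + 1)) :
    ‖logSeries y‖ = ‖1 - y‖ := by
  have hθ := pow_succ_mul_rpow_lt_one p hϖ he
  rcases eq_or_ne (1 - y) 0 with h0 | h0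
  · have hy1 : y = 1 := (sub_eq_zero.mp h0).symm
    rw [hy1, logSeries_one, sub_self]
  have hlt : ‖logSeries y + (1 - y)‖ < ‖1 - y‖ := by
    calc ‖logSeries y + (1 - y)‖
        ≤ ‖(ϖ : K)‖ ^ (s + 1) * (p : ℝ) ^ (1 / ((p : ℝ) - 1)) * ‖1 - y‖ :=
          norm_logSeries_add_le p K hθ.le hy
      _ < 1 * ‖1 - y‖ := by gcongr
      _ = ‖1 - y‖ := one_mul _
  have hne : ‖logSeries y + (1 - y)‖ ≠ ‖-(1 - y)‖ := by rw [norm_neg]; exact hlt.ne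
  calc ‖logSeries y‖ = ‖(logSeries y + (1 - y)) + (-(1 - y))‖ := by rw [add_neg_cancel_right]
    _ = max ‖logSeries y + (1 - y)‖ ‖-(1 - y)‖ := norm_add_eq_max_of_norm_ne_norm hne
    _ = ‖1 - y‖ := by rw [norm_neg, max_eq_right hlt.le]

/-- At the tie level the logarithmic series is `1`-Lipschitz on `U^{(s)}`: `‖L(y)‖ ≤ ‖1 − y‖` for
`‖1 − y‖ ≤ ‖ϖ‖ˢ`. [cite: Koblitz1984, Ch. IV §1] -/
theorem norm_logSeries_le_of_le_pow {y : K} (hy : ‖1 - y‖ ≤ ‖(ϖ : K)‖ ^ s) : ‖logSeries y‖ ≤ ‖1 - y‖ := by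
  rw [← norm_pow] at hy
  exact norm_logSeries_le_norm p K (le_of_eq (norm_mul_rpow_eq_one p (norm_pow_level_pow_eq p hϖ he))) hy

/-- If `‖a‖ ≤ 1` and `a + c·a^p ∈ 𝔪` (`c = ϖ^{s(p−1)}/p`) then `log_p(1 + ϖˢa) ∈ 𝔪^{s+1}`.
[cite: Washington1997, §5.1] -/
theorem norm_logSeries_le_pow_succ_of_norm_lt_one (hp2 : p ≠ 2) {a : K} (ha : ‖a‖ ≤ 1)
    (hΛ : ‖a + ((ϖ : K) ^ s) ^ (p - 1) / p * a ^ p‖ < 1) :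
    ‖logSeries (1 + (ϖ : K) ^ s * a)‖ ≤ ‖(ϖ : K)‖ ^ (s + 1) := by
  have hπ := norm_pow_level_pow_eq p hϖ he
  have h := (norm_logSeries_one_add_sub_le p hπ hp2 ha).trans (pow_two_mul_le_pow_succ p hϖ he)
  have hΛ' : ‖(ϖ : K) ^ s * (a + ((ϖ : K) ^ s) ^ (p - 1) / p * a ^ p)‖ ≤ ‖(ϖ : K)‖ ^ (s + 1) := by
    rw [norm_mul, norm_pow, pow_succ]
    exact mul_le_mul_of_nonneg_left (hϖ.norm_le_of_norm_lt_one _ hΛ) (by positivity)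
  have := norm_add_le_max (logSeries (1 + (ϖ : K) ^ s * a) -
      (ϖ : K) ^ s * (a + ((ϖ : K) ^ s) ^ (p - 1) / p * a ^ p))
    ((ϖ : K) ^ s * (a + ((ϖ : K) ^ s) ^ (p - 1) / p * a ^ p))
  rw [sub_add_cancel] at this
  exact this.trans (max_le h hΛ')

/-- Conversely, if `‖a‖ ≤ 1` and `log_p(1 + ϖˢa) ∈ 𝔪^{s+1}` then `a + c·a^p ∈ 𝔪`. [cite: Washington1997, §5.1] -/
theorem norm_lt_one_of_norm_logSeries_le_pow_succ (hp2 : p ≠ 2) {a : K} (ha : ‖a‖ ≤ 1)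
    (hL : ‖logSeries (1 + (ϖ : K) ^ s * a)‖ ≤ ‖(ϖ : K)‖ ^ (s + 1)) :
    ‖a + ((ϖ : K) ^ s) ^ (p - 1) / p * a ^ p‖ < 1 := by
  have hπ := norm_pow_level_pow_eq p hϖ he
  have hr0 : 0 < ‖(ϖ : K)‖ ^ s := pow_pos (norm_units_pos ϖ) s
  have h := (norm_logSeries_one_add_sub_le p hπ hp2 ha).trans (pow_two_mul_le_pow_succ p hϖ he)
  have h2 : ‖(ϖ : K) ^ s * (a + ((ϖ : K) ^ s) ^ (p - 1) / p * a ^ p)‖ ≤ ‖(ϖ : K)‖ ^ (s + 1) := by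
    have := norm_add_le_max (logSeries (1 + (ϖ : K) ^ s * a))
      (-(logSeries (1 + (ϖ : K) ^ s * a) - (ϖ : K) ^ s * (a + ((ϖ : K) ^ s) ^ (p - 1) / p * a ^ p)))
    rw [norm_neg, ← sub_eq_add_neg, sub_sub_cancel] at this
    exact this.trans (max_le hL h)
  rw [norm_mul, norm_pow, pow_succ] at h2
  have h3 : ‖a + ((ϖ : K) ^ s) ^ (p - 1) / p * a ^ p‖ ≤ ‖(ϖ : K)‖ := le_of_mul_le_mul_left h2 hr0
  exact h3.trans_lt hϖ.norm_lt_one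

/-- For `‖a‖, ‖b‖ ≤ 1`: `a + c·a^p ≡ b (mod 𝔪)` ⇒ `log_p(1 + ϖˢa) ≡ ϖˢb (mod 𝔪^{s+1})`. [cite: Washington1997, §5.1] -/
theorem norm_logSeries_sub_mul_le_pow_succ_of_norm_sub_lt_one (hp2 : p ≠ 2) {a b : K} (ha : ‖a‖ ≤ 1)
    (hab : ‖a + ((ϖ : K) ^ s) ^ (p - 1) / p * a ^ p - b‖ < 1) :
    ‖logSeries (1 + (ϖ : K) ^ s * a) - (ϖ : K) ^ s * b‖ ≤ ‖(ϖ : K)‖ ^ (s + 1) := by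
  have hπ := norm_pow_level_pow_eq p hϖ he
  have h := (norm_logSeries_one_add_sub_le p hπ hp2 ha).trans (pow_two_mul_le_pow_succ p hϖ he)
  have h2 : ‖(ϖ : K) ^ s * (a + ((ϖ : K) ^ s) ^ (p - 1) / p * a ^ p) - (ϖ : K) ^ s * b‖ ≤
      ‖(ϖ : K)‖ ^ (s + 1) := by
    rw [← mul_sub, norm_mul, norm_pow, pow_succ]
    exact mul_le_mul_of_nonneg_left (hϖ.norm_le_of_norm_lt_one _ hab) (by positivity)
  have := norm_add_le_max (logSeries (1 + (ϖ : K) ^ s * a) -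
      (ϖ : K) ^ s * (a + ((ϖ : K) ^ s) ^ (p - 1) / p * a ^ p))
    ((ϖ : K) ^ s * (a + ((ϖ : K) ^ s) ^ (p - 1) / p * a ^ p) - (ϖ : K) ^ s * b)
  rw [sub_add_sub_cancel] at this
  exact this.trans (max_le h h2)

/-- And conversely: `log_p(1 + ϖˢa) ≡ ϖˢb (mod 𝔪^{s+1})` ⇒ `a + c·a^p ≡ b (mod 𝔪)`. [cite: Washington1997, §5.1] -/
theorem norm_sub_lt_one_of_norm_logSeries_sub_mul_le_pow_succ (hp2 : p ≠ 2) {a b : K} (ha : ‖a‖ ≤ 1)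
    (hL : ‖logSeries (1 + (ϖ : K) ^ s * a) - (ϖ : K) ^ s * b‖ ≤ ‖(ϖ : K)‖ ^ (s + 1)) :
    ‖a + ((ϖ : K) ^ s) ^ (p - 1) / p * a ^ p - b‖ < 1 := by
  have hπ := norm_pow_level_pow_eq p hϖ he
  have hr0 : 0 < ‖(ϖ : K)‖ ^ s := pow_pos (norm_units_pos ϖ) s
  have h := (norm_logSeries_one_add_sub_le p hπ hp2 ha).trans (pow_two_mul_le_pow_succ p hϖ he)
  have h2 : ‖(ϖ : K) ^ s * (a + ((ϖ : K) ^ s) ^ (p - 1) / p * a ^ p) - (ϖ : K) ^ s * b‖ ≤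
      ‖(ϖ : K)‖ ^ (s + 1) := by
    have := norm_add_le_max (logSeries (1 + (ϖ : K) ^ s * a) - (ϖ : K) ^ s * b)
      (-(logSeries (1 + (ϖ : K) ^ s * a) - (ϖ : K) ^ s * (a + ((ϖ : K) ^ s) ^ (p - 1) / p * a ^ p)))
    rw [norm_neg, ← sub_eq_add_neg, sub_sub_sub_cancel_left] at this
    exact this.trans (max_le hL h)
  rw [← mul_sub, norm_mul, norm_pow, pow_succ] at h2
  exact (le_of_mul_le_mul_left h2 hr0).trans_lt hϖ.norm_lt_one

end Level

end FirstTieLevel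

end Literature.IUT.LogVolume

end
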